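import Literature.MathematicalPhysics.QuantumLattice.HubbardWindowCertificate
import Literature.MathematicalPhysics.QuantumLattice.BdGBondHamiltonian
import Literature.MathematicalPhysics.QuantumLattice.MagneticHubbardTorusGauge
import Summits.Ventures.CertifiedManyBodySolver.Rows.FluxTorusGaugeAut
import HarnessLib

/-!
# Spin-twisted torus ceiling I — the ORBITAL gauge automorphism `Ad(W_g)`, `g : Orb Λ → U(1)`

HONEST FRAMING: first certified bounds; not a superconductivity verdict; every number certified or
labelled float. The site-phase gauge `phaseGauge g` (`g : Λ → U(1)`, both spins alike) of
`FluxTorusGaugeAut.lean` generalised to one phase PER ORBITAL `(x, σ)`: `W_g = diag(∏_{o ∈ s} g o)`.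
This is the gauge group `U(1)_↑ × U(1)_↓` (per site) needed to transport window certificates to tori
with SPIN-DEPENDENT seam phases (spin-twisted boundary conditions; cal-3 gen-16 ADMISSIBILITY.md):
its action on letters, ladder words (unimodular phases `orbWordGauge`), Gram forms, and its
naturality under second-quantised embeddings `Γ(φ)`. `phaseGauge g = orbPhaseGauge (g ∘ site)`.
[cite: KomaTasakiPRL1992, eq. (5)] [cite: BratteliRobinsonII1997, §5.2.2]
-/

noncomputable section

open Matrix Finset
open Literature.MathematicalPhysics.QuantumLattice
open Literature.MathematicalPhysics.QuantumFieldTheory hiding Site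
open Literature.MathematicalPhysics.QuantumManyBody.StateRelaxation
open Literature.Probability.LatticeModels
open HubbardWave0
open scoped ComplexOrder ComplexConjugate

namespace Summit.Ventures.CertifiedManyBodySolver.Rows

section OrbGauge

variable {Λ Λ' : Type*} [LinearOrder Λ] [Fintype Λ] [LinearOrder Λ'] [Fintype Λ']

/-- The unitary ORBITAL-phase transformation `|s⟩ ↦ (∏_{o ∈ s} g o) |s⟩`, `g : Orb Λ → U(1)` —
`exp[i Σ_{x,σ} θ_{xσ} n_{xσ}]` for `g = e^{iθ}`; `θ_{x↑} = -θ_{x↓}` is a rotation about `S^z`.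
[cite: KomaTasakiPRL1992, eq. (5)] -/
def orbPhaseGauge (g : Orb Λ → Circle) : Matrix (Finset (Orb Λ)) (Finset (Orb Λ)) ℂ :=
  diagonal fun s => ((∏ o ∈ s, g o : Circle) : ℂ)

omit [Fintype Λ] in
/-- The site-phase gauge is the orbital gauge of a spin-blind phase. [folklore] -/
theorem phaseGauge_eq_orbPhaseGauge (g : Λ → Circle) :
    phaseGauge g = orbPhaseGauge (fun o : Orb Λ => g (ofLex o).1) := rfl

/-- `z · conj z = 1` on the unit circle. [folklore] -/
private theorem circle_coe_mul_conj' (z : Circle) : (z : ℂ) * conj (z : ℂ) = 1 := by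
  rw [Complex.mul_conj, Circle.normSq_coe, Complex.ofReal_one]

/-- `W_gᴴ W_g = 1`. [folklore] -/
theorem orbPhaseGauge_conjTranspose_mul_self (g : Orb Λ → Circle) :
    (orbPhaseGauge g)ᴴ * orbPhaseGauge g = 1 := by
  rw [orbPhaseGauge, diagonal_conjTranspose, diagonal_mul_diagonal, ← diagonal_one]
  congr 1
  funext s
  rw [Pi.star_apply, Complex.star_def, mul_comm, circle_coe_mul_conj']

/-- `W_g W_gᴴ = 1`. [folklore] -/
theorem orbPhaseGauge_mul_conjTranspose_self (g : Orb Λ → Circle) :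
    orbPhaseGauge g * (orbPhaseGauge g)ᴴ = 1 := by
  rw [orbPhaseGauge, diagonal_conjTranspose, diagonal_mul_diagonal, ← diagonal_one]
  congr 1
  funext s
  rw [Pi.star_apply, Complex.star_def, circle_coe_mul_conj']

/-- Multiplicativity `W_{fg} = W_f W_g`. [folklore] -/
theorem orbPhaseGauge_mul (f g : Orb Λ → Circle) :
    orbPhaseGauge (f * g) = orbPhaseGauge f * orbPhaseGauge g := by
  rw [orbPhaseGauge, orbPhaseGauge, orbPhaseGauge, diagonal_mul_diagonal]
  congr 1
  funext s
  rw [← Circle.coe_mul, ← Finset.prod_mul_distrib]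
  rfl

/-- `W_g c_i W_gᴴ = conj(g i) c_i`. [cite: KomaTasakiPRL1992, eqs. (7)–(8)] -/
theorem orbPhaseGauge_mul_annihilation_mul_conjTranspose (g : Orb Λ → Circle) (i : Orb Λ) :
    orbPhaseGauge g * annihilation i * (orbPhaseGauge g)ᴴ = conj (g i : ℂ) • annihilation i := by
  ext s t
  simp only [orbPhaseGauge, diagonal_conjTranspose, diagonal_mul, mul_diagonal, Pi.star_apply,
    Matrix.smul_apply, smul_eq_mul, annihilation, Complex.star_def]
  split_ifs with h
  · rw [h.2, Finset.prod_insert h.1, Circle.coe_mul, map_mul]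
    linear_combination (conj (g i : ℂ) * jwSign i s) * circle_coe_mul_conj' (∏ o ∈ s, g o)
  · simp

/-- `W_g c†_i W_gᴴ = (g i) c†_i`. [cite: KomaTasakiPRL1992, eqs. (7)–(8)] -/
theorem orbPhaseGauge_mul_creation_mul_conjTranspose (g : Orb Λ → Circle) (i : Orb Λ) :
    orbPhaseGauge g * creation i * (orbPhaseGauge g)ᴴ = (g i : ℂ) • creation i := by
  have h := congrArg conjTranspose (orbPhaseGauge_mul_annihilation_mul_conjTranspose g i)
  rw [conjTranspose_mul, conjTranspose_mul, conjTranspose_conjTranspose, annihilation_conjTranspose,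
    conjTranspose_smul, annihilation_conjTranspose, ← mul_assoc] at h
  rw [h, Complex.star_def, Complex.conj_conj]

/-- Conjugation by `W_g` is multiplicative. [folklore] -/
theorem orbPhaseGauge_mul_mul_mul_conjTranspose (g : Orb Λ → Circle)
    (X Y : Matrix (Finset (Orb Λ)) (Finset (Orb Λ)) ℂ) :
    orbPhaseGauge g * (X * Y) * (orbPhaseGauge g)ᴴ =
      orbPhaseGauge g * X * (orbPhaseGauge g)ᴴ * (orbPhaseGauge g * Y * (orbPhaseGauge g)ᴴ) := by
  calc orbPhaseGauge g * (X * Y) * (orbPhaseGauge g)ᴴ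
      = orbPhaseGauge g * X * ((orbPhaseGauge g)ᴴ * orbPhaseGauge g) * Y * (orbPhaseGauge g)ᴴ := by
        rw [orbPhaseGauge_conjTranspose_mul_self]; noncomm_ring
    _ = _ := by noncomm_ring

/-- `Ad(W_g) : a ↦ W_g a W_gᴴ` for the orbital phase unitary. [folklore] -/
def orbGaugeAut (g : Orb Λ → Circle) :
    Matrix (Finset (Orb Λ)) (Finset (Orb Λ)) ℂ →ₐ[ℂ] Matrix (Finset (Orb Λ)) (Finset (Orb Λ)) ℂ where
  toFun b := orbPhaseGauge g * b * (orbPhaseGauge g)ᴴ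
  map_one' := by rw [Matrix.mul_one, orbPhaseGauge_mul_conjTranspose_self]
  map_mul' b c := orbPhaseGauge_mul_mul_mul_conjTranspose g b c
  map_zero' := by rw [Matrix.mul_zero, Matrix.zero_mul]
  map_add' b c := by rw [Matrix.mul_add, Matrix.add_mul]
  commutes' c := by
    rw [Algebra.algebraMap_eq_smul_one, Matrix.mul_smul, Matrix.mul_one, Matrix.smul_mul,
      orbPhaseGauge_mul_conjTranspose_self]

/-- `Ad(W_g) b = W_g b W_gᴴ` (definitional). [folklore] -/
theorem orbGaugeAut_apply (g : Orb Λ → Circle) (b : Matrix (Finset (Orb Λ)) (Finset (Orb Λ)) ℂ) :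
    orbGaugeAut g b = orbPhaseGauge g * b * (orbPhaseGauge g)ᴴ := rfl

/-- The spin-blind orbital gauge automorphism is the site gauge automorphism. [folklore] -/
theorem gaugeAut_eq_orbGaugeAut (g : Λ → Circle) (b : Matrix (Finset (Orb Λ)) (Finset (Orb Λ)) ℂ) :
    gaugeAut g b = orbGaugeAut (fun o : Orb Λ => g (ofLex o).1) b := rfl

/-- `Ad(W_g) a_i = conj g(i) • a_i`. [folklore] -/
theorem orbGaugeAut_annihilation (g : Orb Λ → Circle) (i : Orb Λ) :
    orbGaugeAut g (annihilation i) = conj (g i : ℂ) • annihilation i :=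
  orbPhaseGauge_mul_annihilation_mul_conjTranspose g i

/-- `Ad(W_g) a†_i = g(i) • a†_i`. [folklore] -/
theorem orbGaugeAut_creation (g : Orb Λ → Circle) (i : Orb Λ) :
    orbGaugeAut g (creation i) = (g i : ℂ) • creation i :=
  orbPhaseGauge_mul_creation_mul_conjTranspose g i

/-- `Ad(W_g)` is a `*`-map. [folklore] -/
theorem orbGaugeAut_conjTranspose (g : Orb Λ → Circle) (b : Matrix (Finset (Orb Λ)) (Finset (Orb Λ)) ℂ) :
    orbGaugeAut g bᴴ = (orbGaugeAut g b)ᴴ := by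
  rw [orbGaugeAut_apply, orbGaugeAut_apply, conjTranspose_mul, conjTranspose_mul,
    conjTranspose_conjTranspose, mul_assoc]

/-- Number operators are gauge invariant. [folklore] -/
theorem orbGaugeAut_numberOp (g : Orb Λ → Circle) (x : Λ) (σ : Fin 2) :
    orbGaugeAut g (numberOp x σ) = numberOp x σ := by
  rw [numberOp, map_mul, orbGaugeAut_creation, orbGaugeAut_annihilation, smul_mul_smul,
    circle_coe_mul_conj', one_smul]

/-- The orbital map induced by a site embedding. -/
def orbMap (φ : Λ ↪ Λ') (o : Orb Λ) : Orb Λ' := orb (φ (ofLex o).1) (ofLex o).2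

/-- **Naturality**: `Ad(W_g) ∘ Γ(φ) = Γ(φ) ∘ Ad(W_{g ∘ orbMap φ})`. [folklore] -/
theorem orbGaugeAut_fermionEmbed (g : Orb Λ' → Circle) (φ : Λ ↪ Λ')
    (Z : Matrix (Finset (Orb Λ)) (Finset (Orb Λ)) ℂ) :
    orbGaugeAut g (fermionEmbed φ Z) = fermionEmbed φ (orbGaugeAut (g ∘ orbMap φ) Z) := by
  have key : (orbGaugeAut g).comp (fermionEmbed φ) =
      (fermionEmbed φ).comp (orbGaugeAut (g ∘ orbMap φ)) := by
    refine algHom_ext_car (fun i => ?_) (fun i => ?_)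
    · rw [AlgHom.comp_apply, AlgHom.comp_apply, fermionEmbed_annihilation', orbGaugeAut_annihilation,
        orbGaugeAut_annihilation, map_smul, fermionEmbed_annihilation']
      rfl
    · rw [AlgHom.comp_apply, AlgHom.comp_apply, fermionEmbed_creation', orbGaugeAut_creation,
        orbGaugeAut_creation, map_smul, fermionEmbed_creation']
      rfl
  exact congrArg (fun f : _ →ₐ[ℂ] _ => f Z) key

/-- The phase a ladder word picks up under the orbital `Ad(W_g)`. -/
def orbWordGauge (g : Orb Λ → Circle) (l : List (Orb Λ × Bool)) : Circle :=
  (l.map fun p => if p.2 then g p.1 else (g p.1)⁻¹).prod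

omit [LinearOrder Λ] [Fintype Λ] in
/-- The empty word picks up no phase. [folklore] -/
@[simp] theorem orbWordGauge_nil (g : Orb Λ → Circle) : orbWordGauge g [] = 1 := by
  simp [orbWordGauge]

omit [LinearOrder Λ] [Fintype Λ] in
/-- Word phase of a cons. [folklore] -/
theorem orbWordGauge_cons (g : Orb Λ → Circle) (p : Orb Λ × Bool) (l : List (Orb Λ × Bool)) :
    orbWordGauge g (p :: l) = (if p.2 then g p.1 else (g p.1)⁻¹) * orbWordGauge g l := by
  simp [orbWordGauge]

/-- `Ad(W_g)` of a single ladder letter. [folklore] -/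
theorem orbGaugeAut_ladderLetter (g : Orb Λ → Circle) (p : Orb Λ × Bool) :
    orbGaugeAut g (ladderLetter p) =
      ((if p.2 then g p.1 else (g p.1)⁻¹ : Circle) : ℂ) • ladderLetter p := by
  rcases p with ⟨i, b⟩
  cases b
  · simp only [ladderLetter, if_false, Bool.false_eq_true]
    rw [orbGaugeAut_annihilation, Circle.coe_inv_eq_conj]
  · simp only [ladderLetter, if_true]
    rw [orbGaugeAut_creation]

/-- `Ad(W_g)(a₁⋯aₖ) = (∏ phases) • a₁⋯aₖ`. [folklore] -/
theorem orbGaugeAut_ladderWord (g : Orb Λ → Circle) (l : List (Orb Λ × Bool)) :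
    orbGaugeAut g (ladderWord l) = (orbWordGauge g l : ℂ) • ladderWord l := by
  induction l with
  | nil => simp
  | cons p l ih =>
    rw [ladderWord_cons, map_mul, ih, orbGaugeAut_ladderLetter, smul_mul_smul, orbWordGauge_cons,
      Circle.coe_mul]

omit [LinearOrder Λ] [Fintype Λ] in
/-- Word phases are unimodular. [folklore] -/
theorem norm_orbWordGauge (g : Orb Λ → Circle) (l : List (Orb Λ × Bool)) :
    ‖(orbWordGauge g l : ℂ)‖ = 1 :=
  Circle.norm_coe _

/-- `Ad(W_g)` of a Gram form is the Gram form of the conjugated observables. [folklore] -/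
theorem orbGaugeAut_gramForm (g : Orb Λ → Circle) {m : Type*} [Fintype m] (Λm : Matrix m m ℂ)
    (O : m → Matrix (Finset (Orb Λ)) (Finset (Orb Λ)) ℂ) :
    orbGaugeAut g (gramForm Λm O) = gramForm Λm (fun i => orbGaugeAut g (O i)) := by
  simp only [gramForm, map_sum, map_smul, map_mul, star_eq_conjTranspose, orbGaugeAut_conjTranspose]

/-- `Ad(W_{fg}) = Ad(W_f) ∘ Ad(W_g)`. [folklore] -/
theorem orbGaugeAut_mul_apply (f g : Orb Λ → Circle) (b : Matrix (Finset (Orb Λ)) (Finset (Orb Λ)) ℂ) :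
    orbGaugeAut (f * g) b = orbGaugeAut f (orbGaugeAut g b) := by
  rw [orbGaugeAut_apply, orbGaugeAut_apply, orbGaugeAut_apply, orbPhaseGauge_mul, conjTranspose_mul]
  noncomm_ring

/-! ### §2. Unitary group structure and sector invariance of the orbital gauge -/

omit [Fintype Λ] in
/-- `W_gᴴ = W_{g⁻¹}`. [cite: KomaTasakiPRL1992, eq. (5)] -/
theorem orbPhaseGauge_conjTranspose (g : Orb Λ → Circle) : (orbPhaseGauge g)ᴴ = orbPhaseGauge g⁻¹ := by
  rw [orbPhaseGauge, orbPhaseGauge, diagonal_conjTranspose]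
  congr 1
  funext s
  rw [Pi.star_apply, Complex.star_def, ← Circle.coe_inv_eq_conj, ← Finset.prod_inv_distrib]
  rfl

omit [Fintype Λ] in
/-- The trivial orbital phase acts as the identity. [folklore] -/
@[simp] theorem orbPhaseGauge_one : orbPhaseGauge (1 : Orb Λ → Circle) = 1 := by
  simp [orbPhaseGauge]

/-- `W_g` is unitary. [cite: KomaTasakiPRL1992, eq. (5)] -/
theorem orbPhaseGauge_mem_unitaryGroup (g : Orb Λ → Circle) :
    orbPhaseGauge g ∈ Matrix.unitaryGroup (Finset (Orb Λ)) ℂ := by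
  rw [Matrix.mem_unitaryGroup_iff']
  exact orbPhaseGauge_conjTranspose_mul_self g

/-- `(W_g ψ)(s) = (∏_{o ∈ s} g o) ψ(s)`. [cite: KomaTasakiPRL1992, eq. (5)] -/
theorem orbPhaseGauge_mulVec_apply (g : Orb Λ → Circle) (ψ : Fock (Orb Λ)) (s : Finset (Orb Λ)) :
    (orbPhaseGauge g *ᵥ ψ) s = ((∏ o ∈ s, g o : Circle) : ℂ) * ψ s := by
  rw [orbPhaseGauge, mulVec_diagonal]

/-- **Orbital gauge transformations preserve every joint sector `(N, S^z = M)`** (diagonal in the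
occupation basis). [cite: KomaTasakiPRL1992, eq. (5)] -/
theorem orbPhaseGauge_mulVec_mem_szSector (g : Orb Λ → Circle) {N : ℕ} {M : ℝ}
    {ψ : Fock (Orb Λ)} (h : ψ ∈ szSector N M) : orbPhaseGauge g *ᵥ ψ ∈ szSector N M := by
  rw [mem_szSector_iff] at h ⊢
  obtain ⟨hN, hZ⟩ := h
  refine ⟨fun s hs => by rw [orbPhaseGauge_mulVec_apply, hN s hs, mul_zero], ?_⟩
  funext s
  have hs := congrFun hZ s
  rw [LiebThm1.spinZ_mulVec_apply, Pi.smul_apply, smul_eq_mul] at hs ⊢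
  rw [orbPhaseGauge_mulVec_apply]
  linear_combination ((∏ o ∈ s, g o : Circle) : ℂ) * hs

/-- `W_gᴴ` preserves the joint sectors as well. [cite: KomaTasakiPRL1992, eq. (5)] -/
theorem orbPhaseGauge_conjTranspose_mulVec_mem_szSector (g : Orb Λ → Circle) {N : ℕ} {M : ℝ}
    {ψ : Fock (Orb Λ)} (h : ψ ∈ szSector N M) : (orbPhaseGauge g)ᴴ *ᵥ ψ ∈ szSector N M := by
  rw [orbPhaseGauge_conjTranspose]
  exact orbPhaseGauge_mulVec_mem_szSector _ h

/-- **Sector energies are invariant under orbital-phase conjugation.** [cite: KomaTasakiPRL1992, eq. (5)] -/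
theorem minEnergyOn_szSector_orbPhaseGauge_conj (g : Orb Λ → Circle)
    (H : Matrix (Finset (Orb Λ)) (Finset (Orb Λ)) ℂ) (N : ℕ) (M : ℝ) :
    ((orbPhaseGauge g)ᴴ * H * orbPhaseGauge g).minEnergyOn (szSector N M) =
      H.minEnergyOn (szSector N M) :=
  Matrix.minEnergyOn_conjTranspose_mul_mul H (orbPhaseGauge g) _ (orbPhaseGauge_conjTranspose_mul_self g)
    (orbPhaseGauge_mul_conjTranspose_self g) (fun _ h => orbPhaseGauge_mulVec_mem_szSector g h)
    fun _ h => orbPhaseGauge_conjTranspose_mulVec_mem_szSector g h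

end OrbGauge

end Summit.Ventures.CertifiedManyBodySolver.Rows
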